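import Literature.Barriers.CriticalPhenomena.RigorousRGSmallParameterTphiPolynomial
import Literature.Barriers.CriticalPhenomena.RigorousRGSmallParameterTphiExponential
import HarnessLib

/-!
# `RigorousRGSmallParameter` (Slade, Theorem 1.4.1): the `T_φ` seminorm of [BS-rg-norm] —
# VII. The field Laplacian `Δ_C` and the Laplacian norm estimate (Brydges–Slade Lemma 6.1.1 /
# Proposition 3.8.1: `½‖Δ_CF‖_{T_φ} ≤ binom(A,2)‖C‖_Φ‖F‖_{T_φ}`)

Sequel of `RigorousRGSmallParameterTphiPolynomial.lean` / `…TphiExponential.lean`. The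
Gaussian expectation acts on polynomials through `E_C θ = e^{½Δ_C}` with
`Δ_C = Σ_{u,v} C_{u,v} ∂_{φ_u}∂_{φ_v}` ([BS-rg-norm] (LapC), (ELap); Slade (4.11) `ℒ_C`), and
[BS-rg-norm] Proposition 3.8.1 — "If `F ∈ 𝒩` is a polynomial of degree at most `A`, with
`A ≤ p_𝒩`, then `‖Δ_CF‖_{T_φ} ≤ A²‖C‖_Φ‖F‖_{T_φ}` and `‖e^{tΔ_C}F‖ ≤ e^{|t|A²‖C‖_Φ}‖F‖_{T_φ}`"
(`C` "regarded as a test function" supported on sequences of length two) — bounds the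
Laplacian, hence `E_Cθ`, on polynomials. Its printed proof is Lemma 6.1.1 (§6.1):
`½⟨Δ_CF, g⟩_φ = ⟨F, C*g⟩_φ` with `(C*g)_v = 𝟙_{u∘z=v}(v!/(u!z!))C_ug_z` for `|v| ≤ A`, and
`‖C*g‖_Φ ≤ binom(A,2)‖C‖_Φ‖g‖_Φ` (products of test functions). This file formalises exactly this
(one real boson species; the lattice norms `Φ(𝔥)` of file III for the bound):

* `coeff_coeff` (`(F_{z'})_w = F_{w∘z'}`), `lapC` (`Δ_C`), `covFn` (`C` as a test function),
  `coeff_finset_sum`, **`coeff_lapC`** (`(Δ_CF)_z = Σ_{u,v}C_{uv}F_{z∘(u,v)}`);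
* `covStar` (`C*g`, with `u` the last two coordinates to match `(F_z)_u = F_{z∘u}`), `lapTerm`,
  `pairing_lapC_eq_sum`, `pairing_covStar_eq_sum`, **`pairing_lapC`** (`½⟨Δ_CF,g⟩_φ = ⟨F,C*g⟩_φ`,
  needing only that the coefficients of `F` of length `> A` vanish AT `φ`);
* `covStar_eq_prodFn`, **`covStar_polar`** (`‖C*g‖ ≤ binom(A,2)K` on `B(Φ)` when
  `|∇^βC_{(u,v)}| ≤ K𝔥²R^{-|β|}`, via `prodFn_polar` of file III), and **`TphiNorm_lapC_le`** —
  `½‖Δ_CF‖_{T_φ(𝔥)} ≤ binom(A,2) K ‖F‖_{T_φ(𝔥)}`.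

Everything is proved; no named fact. Ledger effect: none on the trust base of the barrier's
reduction chain (`Slade2017_prop822`).
-/

noncomputable section

namespace Literature.Barriers.CriticalPhenomena

namespace LongRangePhi4

namespace Tphi

open Finset
open scoped ContDiff

variable {Ξ : Type*}
variable {E : Type*} [NormedAddCommGroup E] [NormedSpace ℝ E]

/-! ### The Laplacian `Δ_C = Σ_{u,v} C_{uv} ∂_u ∂_v` on `𝒩` -/

/-- Iterated coefficients compose along concatenation: `(F_{z'})_w = F_{w∘z'}`. [folklore] -/
theorem coeff_coeff (e : Ξ → E) (F : E → ℝ) (z' : List Ξ) :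
    ∀ w : List Ξ, coeff e w (coeff e z' F) = coeff e (w ++ z') F
  | [] => rfl
  | a :: w => by rw [coeff_cons, coeff_coeff e F z' w, List.cons_append, coeff_cons]

variable [Fintype Ξ]

/-- **The Laplacian** `Δ_C F = Σ_{u,v ∈ 𝚲} C_{u,v} F_{(u,v)}` associated with a covariance `C`
("`Δ_C = Σ_{u,v} C_{u,v} ∂/∂φ_u ∂/∂φ_v`", [BS-rg-norm] (LapC); Slade (4.11) `ℒ_C`).
[cite: BrydgesSlade2015RGI, §2.3 (display (LapC) defining Δ_C)] [cite: Slade2017, §4.3 (display defining ℒ_C)] -/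
def lapC (e : Ξ → E) (C : Ξ → Ξ → ℝ) (F : E → ℝ) : E → ℝ :=
  fun φ => ∑ u : Ξ, ∑ v : Ξ, C u v * coeff e [u, v] F φ

/-- The covariance regarded as a test function supported on sequences of length two. [cite: BrydgesSlade2015RGI, §3.8 (before Proposition 3.8.1: "we regard C as a test function")] -/
def covFn (C : Ξ → Ξ → ℝ) : List Ξ → ℝ
  | [u, v] => C u v
  | _ => 0

omit [Fintype Ξ] in
/-- `covFn` on a two-letter sequence. [folklore] -/
@[simp] theorem covFn_pair (C : Ξ → Ξ → ℝ) (u v : Ξ) : covFn C [u, v] = C u v := rfl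

/-- `Δ_C F` is smooth for smooth `F`. [folklore] -/
theorem contDiff_lapC (e : Ξ → E) (C : Ξ → Ξ → ℝ) {F : E → ℝ} (hF : ContDiff ℝ ∞ F) :
    ContDiff ℝ ∞ (lapC e C F) := by
  unfold lapC
  exact ContDiff.sum fun u _ => ContDiff.sum fun v _ => contDiff_const.mul (contDiff_coeff e hF _)

omit [Fintype Ξ] in
/-- Coefficients of finite sums. [folklore] -/
theorem coeff_finset_sum (e : Ξ → E) {β : Type*} (s : Finset β) {F : β → E → ℝ}
    (hF : ∀ i ∈ s, ContDiff ℝ ∞ (F i)) (z : List Ξ) :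
    coeff e z (fun φ => ∑ i ∈ s, F i φ) = fun φ => ∑ i ∈ s, coeff e z (F i) φ := by
  classical
  induction s using Finset.induction_on with
  | empty =>
    simp only [Finset.sum_empty]
    cases z with
    | nil => rfl
    | cons a z =>
      have := coeff_const_mul e (F := fun _ => (0:ℝ)) contDiff_const 0 (a :: z)
      simpa using this
  | insert b s hb ih =>
    simp only [Finset.sum_insert hb]
    rw [coeff_add e (hF b (by simp)) (ContDiff.sum fun i hi => hF i (by simp [hi])), ih (fun i hi => hF i (by simp [hi]))]

/-- **The coefficients of `Δ_C F`**: `(Δ_CF)_z = Σ_{u,v} C_{uv} F_{z∘(u,v)}`. [folklore] -/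
theorem coeff_lapC (e : Ξ → E) (C : Ξ → Ξ → ℝ) {F : E → ℝ} (hF : ContDiff ℝ ∞ F) (z : List Ξ) :
    coeff e z (lapC e C F) = fun φ => ∑ u : Ξ, ∑ v : Ξ, C u v * coeff e (z ++ [u, v]) F φ := by
  unfold lapC
  rw [coeff_finset_sum e _ (fun u _ => ContDiff.sum fun v _ => contDiff_const.mul (contDiff_coeff e hF _)) z]
  funext φ
  refine Finset.sum_congr rfl fun u _ => ?_
  rw [coeff_finset_sum e _ (fun v _ => contDiff_const.mul (contDiff_coeff e hF _)) z]
  refine Finset.sum_congr rfl fun v _ => ?_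
  have h := coeff_const_mul e (F := coeff e [u, v] F) (contDiff_coeff e hF _) (C u v) z
  rw [h, coeff_coeff]

/-! ### Lemma 6.1.1: `½⟨Δ_CF, g⟩_φ = ⟨F, C*g⟩_φ` and `½‖Δ_CF‖_{T_φ} ≤ binom(A,2)‖C‖_Φ‖F‖_{T_φ}` -/

/-- The adjoint test function `(C*g)_v = 𝟙_{v = z∘u} (v!/(u!z!)) g_z C_u = binom(|v|,2) g_{v_{≤|v|-2}} C_{v_{>|v|-2}}`
for `|v| ≤ A` (`u` the LAST two coordinates of `v`, matching `(F_z)_u = F_{z∘u}`), `0` beyond length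
`A`. [cite: BrydgesSlade2015RGI, Lemma 6.1.1 (display (Cstarg))] -/
def covStar (A : ℕ) (C : Ξ → Ξ → ℝ) (g : List Ξ → ℝ) : List Ξ → ℝ := fun v =>
  if A < v.length then 0
  else (v.length.choose 2 : ℝ) * (g (v.take (v.length - 2)) * covFn C (v.drop (v.length - 2)))

omit [Fintype Ξ] in
/-- `C*g` vanishes beyond length `A`. [folklore] -/
theorem covStar_eq_zero_of_lt {A : ℕ} (C : Ξ → Ξ → ℝ) (g : List Ξ → ℝ) {v : List Ξ} (hv : A < v.length) :
    covStar A C g v = 0 := by simp [covStar, hv]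

/-- The summand common to both sides of Lemma 6.1.1:
`T(r) = (1/r!) Σ_{|v|=r+2} F_v(φ) g_{v_{≤r}} C_{v_{>r}}`. [folklore] -/
def lapTerm (e : Ξ → E) (C : Ξ → Ξ → ℝ) (F : E → ℝ) (φ : E) (g : List Ξ → ℝ) (r : ℕ) : ℝ :=
  ((r.factorial : ℝ)⁻¹) * sumSeq (r + 2) (fun v => coeff e v F φ * (g (v.take r) * covFn C (v.drop r)))

/-- Left-hand side of Lemma 6.1.1: `⟨Δ_CF, g⟩_φ = Σ_{r ≤ p_𝒩} T(r)`. [folklore] -/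
theorem pairing_lapC_eq_sum (e : Ξ → E) (C : Ξ → Ξ → ℝ) {F : E → ℝ} (hF : ContDiff ℝ ∞ F) (pN : ℕ)
    (φ : E) (g : List Ξ → ℝ) :
    pairing pN (coeffFamily e (lapC e C F) φ) g = ∑ r ∈ range (pN + 1), lapTerm e C F φ g r := by
  unfold pairing lapTerm
  refine Finset.sum_congr rfl fun r _ => ?_
  congr 1
  rw [sumSeq_append r 2]
  refine sumSeq_congr r fun z hz => ?_
  simp only [coeffFamily, coeff_lapC e C hF z, Finset.sum_mul, sumSeq_succ, sumSeq_zero]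
  refine Finset.sum_congr rfl fun u _ => Finset.sum_congr rfl fun v _ => ?_
  rw [List.take_append_of_le_length (by omega), List.take_of_length_le (by omega),
    List.drop_append_of_le_length (by omega), List.drop_of_length_le (by omega), List.nil_append,
    covFn_pair]
  ring

/-- Right-hand side of Lemma 6.1.1: `⟨F, C*g⟩_φ = ½ Σ_{2 ≤ m ≤ A} T(m-2)`. [folklore] -/
theorem pairing_covStar_eq_sum (e : Ξ → E) (C : Ξ → Ξ → ℝ) (F : E → ℝ) {A pN : ℕ} (hA : A ≤ pN)
    (φ : E) (g : List Ξ → ℝ) :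
    pairing pN (coeffFamily e F φ) (covStar A C g) =
      ∑ m ∈ Finset.Ico 2 (A + 1), 2⁻¹ * lapTerm e C F φ g (m - 2) := by
  unfold pairing
  -- restrict to `m ≤ A`
  rw [← Finset.sum_range_add_sum_Ico _ (show A + 1 ≤ pN + 1 by omega)]
  rw [Finset.sum_eq_zero (s := Finset.Ico (A + 1) (pN + 1)) (fun m hm => by
    rw [Finset.mem_Ico] at hm
    rw [sumSeq_congr m (g := fun _ => 0), sumSeq_zero_fun, mul_zero]
    intro v hv
    rw [covStar_eq_zero_of_lt C g (by omega), mul_zero]), add_zero]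
  -- restrict to `2 ≤ m`
  rw [Finset.range_eq_Ico, ← Finset.sum_filter_add_sum_filter_not (Finset.Ico 0 (A + 1)) (fun m => 2 ≤ m)]
  rw [Finset.sum_eq_zero (s := (Finset.Ico 0 (A + 1)).filter (fun m => ¬ 2 ≤ m)) (fun m hm => by
    rw [Finset.mem_filter] at hm
    rw [sumSeq_congr m (g := fun _ => 0), sumSeq_zero_fun, mul_zero]
    intro v hv
    simp only [coeffFamily, covStar, hv, Nat.choose_eq_zero_of_lt (Nat.lt_of_not_le hm.2), Nat.cast_zero,
      zero_mul]
    simp), add_zero, Finset.Ico_filter_le, max_eq_right (Nat.zero_le 2)]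
  refine Finset.sum_congr rfl fun m hm => ?_
  rw [Finset.mem_Ico] at hm
  unfold lapTerm
  rw [show m - 2 + 2 = m by omega]
  rw [sumSeq_congr m (g := fun v => (m.choose 2 : ℝ) *
      (coeff e v F φ * (g (v.take (m - 2)) * covFn C (v.drop (m - 2))))) (fun v hv => by
        simp only [coeffFamily, covStar, hv, show ¬ A < m by omega, if_false]
        ring), sumSeq_mul_left]
  have hch : (m.choose 2 : ℝ) * 2 * ((m - 2).factorial : ℝ) = m.factorial := by
    have := Nat.choose_mul_factorial_mul_factorial (show 2 ≤ m by omega)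
    rw [Nat.factorial_two] at this
    exact_mod_cast this
  have h1 : ((m - 2).factorial : ℝ) ≠ 0 := by positivity
  have h2 : (m.choose 2 : ℝ) ≠ 0 := by exact_mod_cast (Nat.choose_pos hm.1).ne'
  rw [← hch]
  field_simp

/-- **`½⟨Δ_CF, g⟩_φ = ⟨F, C*g⟩_φ`** for `F` whose coefficients of length `> A` vanish at `φ`
(a polynomial of degree `≤ A`), `A ≤ p_𝒩`. [cite: BrydgesSlade2015RGI, Lemma 6.1.1 (display ½⟨Δ_CF,g⟩_φ = ⟨F, C*g⟩_φ)] -/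
theorem pairing_lapC (e : Ξ → E) (C : Ξ → Ξ → ℝ) {F : E → ℝ} (hF : ContDiff ℝ ∞ F) {A pN : ℕ}
    (hA : A ≤ pN) (φ : E) (hpoly : ∀ z : List Ξ, A < z.length → coeff e z F φ = 0) (g : List Ξ → ℝ) :
    2⁻¹ * pairing pN (coeffFamily e (lapC e C F) φ) g = pairing pN (coeffFamily e F φ) (covStar A C g) := by
  have hT0 : ∀ r, A < r + 2 → lapTerm e C F φ g r = 0 := by
    intro r hr
    unfold lapTerm
    rw [sumSeq_congr (r + 2) (g := fun _ => 0), sumSeq_zero_fun, mul_zero]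
    intro v hv
    rw [hpoly v (by omega), zero_mul]
  rw [pairing_lapC_eq_sum e C hF pN φ g, pairing_covStar_eq_sum e C F hA φ g, Finset.mul_sum,
    Finset.sum_Ico_eq_sum_range]
  simp only [show ∀ k, 2 + k - 2 = k from fun k => by omega]
  -- `Σ_{r < pN+1} ½T(r) = Σ_{r < A+1-2} ½T(r)`: the extra terms vanish
  symm
  rw [← Finset.sum_range_add_sum_Ico _ (show A + 1 - 2 ≤ pN + 1 by omega)]
  rw [Finset.sum_eq_zero (s := Finset.Ico (A + 1 - 2) (pN + 1)) (fun r hr => by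
    rw [Finset.mem_Ico] at hr
    rw [hT0 r (by omega), mul_zero]), add_zero]

/-! ### Lemma 6.1.1 / Proposition 3.8.1 for the lattice norms `Φ(𝔥)` -/

section latticeLap

variable {Λ : Type*} [AddCommGroup Λ] {ι : Type*} {S : Type*} (step : S → Λ)

omit [Fintype Ξ] [NormedAddCommGroup E] [NormedSpace ℝ E] [AddCommGroup Λ] in
/-- On sequences of length `m ≤ A`, `C*g = binom(m,2) · (g ⊗ C)`. [folklore] -/
theorem covStar_eq_prodFn {A : ℕ} (C : Λ × ι → Λ × ι → ℝ) (g : List (Λ × ι) → ℝ) {m : ℕ} (hm : m ≤ A)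
    {v : List (Λ × ι)} (hv : v.length = m) :
    covStar A C g v = (m.choose 2 : ℝ) * prodFn (m - 2) 2 g (covFn C) v := by
  simp only [covStar, hv, show ¬ A < m by omega, if_false, prodFn]
  by_cases h2 : 2 ≤ m
  · rw [if_pos (by omega)]
  · rw [Nat.choose_eq_zero_of_lt (by omega)]
    simp

/-- **`‖C*g‖_Φ ≤ binom(A,2)‖C‖_Φ` on `B(Φ)`** ("the binomial coefficient in (Cstarg) is at most
`binom(A,2)`; with (plusnormass) this gives `‖C*g‖_Φ ≤ binom(A,2)‖C‖_Φ‖g‖_Φ`"), the covariance norm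
`‖C‖_Φ ≤ K` entering through the unit-ball estimates `|∇^β C_{(u,v)}| ≤ K𝔥²R^{-|β|}`.
[cite: BrydgesSlade2015RGI, Lemma 6.1.1 (proof, display ‖C*g‖_Φ ≤ binom(A,2)‖C‖_Φ‖g‖_Φ)] -/
theorem covStar_polar [Fintype Λ] [Fintype ι] {𝔥 R : ℝ} (h𝔥 : 0 < 𝔥) (hR : 0 < R) {pΦ pN A : ℕ}
    (C : Λ × ι → Λ × ι → ℝ) {K : ℝ} (hK : 0 ≤ K)
    (hC : ∀ (v : List (Λ × ι)), v.length = 2 → ∀ β : List (ℕ × S), Adm pΦ 2 β →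
      |napply step β (covFn C) v| ≤ K * 𝔥 ^ 2 * (R ^ β.length)⁻¹)
    {g : List (Λ × ι) → ℝ} (hg : g ∈ ball pN (latticeFamily step 𝔥 R pΦ)) :
    ∀ ℓ ∈ latticeFamily step 𝔥 R pΦ, |ℓ.toFun (covStar A C g)| ≤ (A.choose 2 : ℝ) * K := by
  rintro _ ⟨β, w, hβ, rfl⟩
  by_cases hA : A < w.length
  · rw [(latticeFun step 𝔥 R β w).local' (covStar A C g) (fun _ => 0) (fun z hz => by
      exact covStar_eq_zero_of_lt C g (by simp [latticeFun] at hz; omega))]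
    rw [show (fun _ : List (Λ × ι) => (0:ℝ)) = 0 from rfl, map_zero, abs_zero]
    positivity
  · push Not at hA
    set m := w.length with hm
    rw [(latticeFun step 𝔥 R β w).local' (covStar A C g)
      (fun v => (m.choose 2 : ℝ) * prodFn (m - 2) 2 g (covFn C) v)
      (fun z hz => covStar_eq_prodFn C g hA (by simpa [latticeFun] using hz))]
    rw [show (fun v => (m.choose 2 : ℝ) * prodFn (m - 2) 2 g (covFn C) v) =
      (m.choose 2 : ℝ) • prodFn (m - 2) 2 g (covFn C) from rfl, map_smul, smul_eq_mul, abs_mul,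
      Nat.abs_cast]
    have hpol := prodFn_polar step h𝔥 hR zero_le_one hK (r := m - 2) (r' := 2) (g' := g) (g'' := covFn C)
      (fun u hu β' hβ' => by
        have hadm : Adm pΦ u.length β' := by rw [hu]; exact hβ'
        have := abs_napply_le_of_mem_ball step h𝔥 hR hg hadm
        rw [hu] at this
        rw [one_mul]; exact this)
      (fun v hv β' hβ' => hC v hv β' hβ') _ ⟨β, w, hβ, rfl⟩
    rw [one_mul] at hpol
    calc (m.choose 2 : ℝ) * |(latticeFun step 𝔥 R β w).toFun (prodFn (m - 2) 2 g (covFn C))|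
        ≤ (m.choose 2 : ℝ) * K := mul_le_mul_of_nonneg_left hpol (Nat.cast_nonneg _)
      _ ≤ (A.choose 2 : ℝ) * K := by
          refine mul_le_mul_of_nonneg_right ?_ hK
          exact_mod_cast Nat.choose_le_choose 2 hA

/-- **Brydges–Slade, Lemma 6.1.1 / Proposition 3.8.1 (Laplacian norm estimate), for the lattice
norms `Φ(𝔥)` (Slade's `T_{φ,j}(𝔥_j)`)**: if the coefficients of `F ∈ 𝒩` of length `> A` vanish at
`φ` (e.g. `F` a polynomial of degree `A ≤ p_𝒩`) and `‖C‖_Φ ≤ K`, then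
`½‖Δ_CF‖_{T_φ} ≤ binom(A,2) K ‖F‖_{T_φ}` (and so `‖Δ_CF‖_{T_φ} ≤ A²‖C‖_Φ‖F‖_{T_φ}`).
[cite: BrydgesSlade2015RGI, Lemma 6.1.1 and Proposition 3.8.1 (display ‖Δ_C F‖_{T_φ} ≤ A²‖C‖_Φ‖F‖_{T_φ})] -/
theorem TphiNorm_lapC_le [Fintype Λ] [Fintype ι] {𝔥 R : ℝ} (h𝔥 : 0 < 𝔥) (hR : 0 < R) {pΦ pN A : ℕ}
    (hApN : A ≤ pN) (e : Λ × ι → E) {F : E → ℝ} (hF : ContDiff ℝ ∞ F) (φ : E)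
    (hpoly : ∀ z : List (Λ × ι), A < z.length → coeff e z F φ = 0)
    (C : Λ × ι → Λ × ι → ℝ) {K : ℝ} (hK : 0 ≤ K)
    (hC : ∀ (v : List (Λ × ι)), v.length = 2 → ∀ β : List (ℕ × S), Adm pΦ 2 β →
      |napply step β (covFn C) v| ≤ K * 𝔥 ^ 2 * (R ^ β.length)⁻¹) :
    2⁻¹ * TphiNorm pN (latticeFamily step 𝔥 R pΦ) e (lapC e C F) φ ≤
      (A.choose 2 : ℝ) * K * TphiNorm pN (latticeFamily step 𝔥 R pΦ) e F φ := by
  rw [inv_mul_le_iff₀ (by norm_num : (0:ℝ) < 2)]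
  unfold TphiNorm
  refine Tnorm_le fun g hg => ?_
  have hid := pairing_lapC e C hF hApN φ hpoly g
  rw [show pairing pN (coeffFamily e (lapC e C F) φ) g =
    2 * pairing pN (coeffFamily e F φ) (covStar A C g) by linarith [hid], abs_mul, abs_two]
  have hb := abs_pairing_le_Tnorm_mul (latticeFamily_evalBound step h𝔥 hR pΦ pN) (coeffFamily e F φ)
    (g := covStar A C g) (fun z hz => covStar_eq_zero_of_lt C g (by omega))
    (covStar_polar step h𝔥 hR C hK hC hg) (by positivity)
  calc 2 * |pairing pN (coeffFamily e F φ) (covStar A C g)|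
      ≤ 2 * (Tnorm pN (latticeFamily step 𝔥 R pΦ) (coeffFamily e F φ) * ((A.choose 2 : ℝ) * K)) := by
        gcongr
    _ = 2 * ((A.choose 2 : ℝ) * K * Tnorm pN (latticeFamily step 𝔥 R pΦ) (coeffFamily e F φ)) := by ring

end latticeLap

end Tphi

end LongRangePhi4

end Literature.Barriers.CriticalPhenomena

end
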